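import Mathlib
import HarnessLib

/-!
# The combinatorial (Hodge) Laplacian of a clique complex and its trace

HONEST FRAMING: instance-level adjudication of specific advantage claims; no claim about
BQP vs BPP or the summit.

For a finite simple graph `G` on a linearly ordered vertex type `V`, the **clique complex**
(flag complex) of `G` has the `(k+1)`-vertex cliques of `G` as its `k`-simplices.  With the
vertices of a simplex listed in increasing order, the simplicial boundary map sends an oriented
`k`-simplex `τ = [v₀ < ⋯ < v_k]` to `Σ_j (-1)^j [v₀, …, v̂_j, …, v_k]` (Horak–Jost write the dual
coboundary, `(δ_i f)([v₀,…,v_{i+1}]) = Σ_j (-1)^j f([v₀,…,v̂_j,…,v_{i+1}])`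
[cite: HorakJost2013, §2]).  We record this as an integer matrix `boundary G k` with rows the
`k`-vertex cliques and columns the `(k+1)`-vertex cliques, and the unweighted combinatorial
Laplace operator `L_k = ∂_{k+1} ∂_{k+1}ᵀ + ∂_kᵀ ∂_k` on `k`-simplices (`(k+1)`-vertex cliques),
`laplacian G k = upLaplacian G k + downLaplacian G k` [cite: HorakJost2013, Definition 2.1 with
`w ≡ 1`, the operator denoted `L_i` on p. 7 there].

Results (all proved, `[folklore]`-level finite combinatorics):

* `boundary_sq` — an entry of `boundary G k` squares to the indicator of the face relation;
* `upLaplacian_apply_self` — the diagonal entry of `∂_{k+1} ∂_{k+1}ᵀ` at a `k`-simplex `σ` is its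
  *degree* `upDegree G k σ = #{(k+1)-simplices containing σ}` [cite: HorakJost2013, §2 explicit
  expressions and Definition 3.1];
* `downLaplacian_apply_self` — the diagonal entry of `∂_kᵀ ∂_k` at a `k`-simplex is `k+1`, the
  number of its facets [cite: HorakJost2013, §2 explicit expressions];
* `sum_upDegree` — double counting: `Σ_σ deg σ = (k+2) · N_{k+2}`;
* `trace_laplacian` — `Tr L_k = (k+1)·N_{k+1} + (k+2)·N_{k+2}`, where `N_j = #(G.cliqueFinset j)`;
* `relTrace_eq` — the normalised ("relative") trace `Tr L_k / N_{k+1} = (k+1) + (k+2)·N_{k+2}/N_{k+1}`;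
* `laplacian_transpose` — `L_k` is symmetric;
* `boundary_mul_boundary` — `∂_k ∂_{k+1} = 0` (the chain-complex identity, checking that the signs
  are the simplicial ones);
* `upLaplacian_posSemidef`, `downLaplacian_posSemidef`, `laplacian_posSemidef` — non-negativity.

Context (cell pub-qadeq, CLAIMS A-58).  Iaconis–Ray–Sekwao–Girotto–Roetteler (IonQ),
arXiv:2607.27206v1, §4, estimate on quantum hardware and in quantum-classical crossover
projections the *first moment* `tr[Δ^Γ_k] = Tr[Δ^Γ_k]/N_k` of the combinatorial Laplacian
restricted to the `k`-cliques of a graph (their eq. (18); `Δ^Γ_k = P_k P_Γ B P_Γ B P_Γ P_k`, p. 26),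
i.e. in the indexing used here `tr[Δ^Γ_k] = Tr (laplacian G (k-1)) / N_k` [cite: IaconisEtAl2026,
§4.1, eq. (18)].  By `relTrace_eq` this observable is the clique-count ratio
`k + (k+1)·N_{k+1}/N_k` — an affine function of the number of `(k+1)`-cliques per `k`-clique — for
every graph; the paper itself notes (p. 33) that the first power "can efficiently be estimated with
alternative classical approaches".  Nothing here concerns higher moments, Betti numbers, or the
paper's hardware experiments; the file states and proves the identity only.
-/

namespace Literature.Combinatorics.SimpleGraph

open Finset Matrix

namespace CliqueComplex

section Sign

variable {V : Type*} [LinearOrder V]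

/-- Incidence sign of the facet `τ.erase v` in the oriented simplex `τ` (vertices listed in
increasing order): `(-1)^j` with `j = #{u ∈ τ | u < v}` the position of `v` in `τ`.
[cite: HorakJost2013, §2] -/
def faceSign (τ : Finset V) (v : V) : ℤ := (-1) ^ #(τ.filter (· < v))

/-- An incidence sign squares to `1`. [folklore] -/
lemma faceSign_sq (τ : Finset V) (v : V) : faceSign τ v ^ 2 = 1 := by
  unfold faceSign
  rw [← pow_mul, mul_comm, pow_mul]
  simp

/-- An incidence sign is `1` or `-1`. [folklore] -/
lemma faceSign_eq_or (τ : Finset V) (v : V) : faceSign τ v = 1 ∨ faceSign τ v = -1 := by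
  unfold faceSign
  rcases Nat.even_or_odd #(τ.filter (· < v)) with h | h
  · exact Or.inl h.neg_one_pow
  · exact Or.inr h.neg_one_pow

/-- Removing a larger vertex does not change the position of a smaller one. [folklore] -/
lemma faceSign_erase_of_lt {τ : Finset V} {a b : V} (hab : a < b) :
    faceSign (τ.erase b) a = faceSign τ a := by
  unfold faceSign
  rw [filter_erase, erase_eq_of_notMem]
  simp only [mem_filter, not_and, not_lt]
  exact fun _ => hab.le

/-- Removing a smaller vertex shifts the position of a larger one by one, flipping its sign.
[folklore] -/
lemma faceSign_erase_of_gt {τ : Finset V} {a b : V} (hab : a < b) (ha : a ∈ τ) :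
    faceSign (τ.erase a) b = -faceSign τ b := by
  unfold faceSign
  rw [filter_erase]
  have hmem : a ∈ τ.filter (· < b) := mem_filter.2 ⟨ha, hab⟩
  rw [← card_erase_add_one hmem, pow_succ]
  ring

end Sign

variable {V : Type*} [Fintype V] [LinearOrder V] (G : SimpleGraph V) [DecidableRel G.Adj]

/-- The simplicial boundary matrix of the clique complex of `G` between `(k+1)`-vertex cliques
(columns, the `k`-simplices) and `k`-vertex cliques (rows, their facets): the entry at `(σ, τ)` is
the incidence sign of `σ` in `τ` when `σ = τ.erase v` for a (necessarily unique) vertex `v ∈ τ`,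
and `0` otherwise. [cite: HorakJost2013, §2] -/
def boundary (k : ℕ) : Matrix (G.cliqueFinset k) (G.cliqueFinset (k + 1)) ℤ :=
  fun σ τ => ∑ v ∈ (τ : Finset V),
    if (σ : Finset V) = (τ : Finset V).erase v then faceSign (τ : Finset V) v else 0

/-- The up Laplacian `∂_{k+1} ∂_{k+1}ᵀ` on `k`-simplices (`(k+1)`-vertex cliques).
[cite: HorakJost2013, Definition 2.1 (i), `w ≡ 1`] -/
def upLaplacian (k : ℕ) : Matrix (G.cliqueFinset (k + 1)) (G.cliqueFinset (k + 1)) ℤ :=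
  boundary G (k + 1) * (boundary G (k + 1))ᵀ

/-- The down Laplacian `∂_kᵀ ∂_k` on `k`-simplices (`(k+1)`-vertex cliques).
[cite: HorakJost2013, Definition 2.1 (ii), `w ≡ 1`] -/
def downLaplacian (k : ℕ) : Matrix (G.cliqueFinset (k + 1)) (G.cliqueFinset (k + 1)) ℤ :=
  (boundary G k)ᵀ * boundary G k

/-- The combinatorial Laplacian `L_k = ∂_{k+1} ∂_{k+1}ᵀ + ∂_kᵀ ∂_k` of the clique complex of `G`
on `k`-simplices (`(k+1)`-vertex cliques). [cite: HorakJost2013, Definition 2.1 (iii), `w ≡ 1`] -/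
def laplacian (k : ℕ) : Matrix (G.cliqueFinset (k + 1)) (G.cliqueFinset (k + 1)) ℤ :=
  upLaplacian G k + downLaplacian G k

/-- The degree of a `k`-simplex `σ` (a `(k+1)`-vertex clique): the number of `(k+2)`-vertex
cliques containing it. [cite: HorakJost2013, Definition 3.1, `w ≡ 1`] -/
def upDegree (k : ℕ) (σ : Finset V) : ℕ := #((G.cliqueFinset (k + 2)).filter (fun τ => σ ⊆ τ))

/-- Unfolding lemma for `upDegree`. [folklore] -/
lemma upDegree_def (k : ℕ) (σ : Finset V) :
    upDegree G k σ = #((G.cliqueFinset (k + 2)).filter (fun τ => σ ⊆ τ)) := rfl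

variable {G}

omit [Fintype V] [DecidableRel G.Adj] in
/-- If a `k`-vertex clique `σ` is contained in a `(k+1)`-vertex clique `τ`, then `σ = τ.erase v`
for a unique `v ∈ τ`. [folklore] -/
lemma exists_eq_erase_of_subset {k : ℕ} {σ τ : Finset V} (hσ : G.IsNClique k σ)
    (hτ : G.IsNClique (k + 1) τ) (h : σ ⊆ τ) : ∃ v ∈ τ, v ∉ σ ∧ σ = τ.erase v := by
  have hcard : #(τ \ σ) = 1 := by
    rw [card_sdiff_of_subset h, hτ.card_eq, hσ.card_eq]; omega
  obtain ⟨v, hv⟩ := card_eq_one.1 hcard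
  have hvmem : v ∈ τ \ σ := by rw [hv]; exact mem_singleton_self v
  rw [mem_sdiff] at hvmem
  refine ⟨v, hvmem.1, hvmem.2, ?_⟩
  ext x
  rw [mem_erase]
  constructor
  · intro hx
    exact ⟨fun hxv => hvmem.2 (hxv ▸ hx), h hx⟩
  · rintro ⟨hxv, hxτ⟩
    by_contra hxσ
    have : x ∈ τ \ σ := mem_sdiff.2 ⟨hxτ, hxσ⟩
    rw [hv, mem_singleton] at this
    exact hxv this

/-- The boundary entry at `(τ.erase v, τ)` is the incidence sign of `v`. [folklore] -/
lemma boundary_apply_erase {k : ℕ} (σ : G.cliqueFinset k) (τ : G.cliqueFinset (k + 1)) {v : V}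
    (hv : v ∈ (τ : Finset V)) (h : (σ : Finset V) = (τ : Finset V).erase v) :
    boundary G k σ τ = faceSign (τ : Finset V) v := by
  unfold boundary
  rw [sum_eq_single_of_mem v hv]
  · rw [if_pos h]
  · intro w hw hwv
    rw [if_neg]
    intro h'
    exact hwv ((erase_inj (τ : Finset V) hw).1 (h'.symm.trans h))

/-- The boundary entry vanishes off the face relation. [folklore] -/
lemma boundary_apply_of_not_subset {k : ℕ} (σ : G.cliqueFinset k) (τ : G.cliqueFinset (k + 1))
    (h : ¬ (σ : Finset V) ⊆ (τ : Finset V)) : boundary G k σ τ = 0 := by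
  unfold boundary
  refine sum_eq_zero fun v _ => ?_
  rw [if_neg]
  intro h'
  exact h (h' ▸ erase_subset v (τ : Finset V))

/-- An entry of the boundary matrix squares to the indicator of the face relation `σ ⊆ τ`.
[folklore] -/
lemma boundary_sq (k : ℕ) (σ : G.cliqueFinset k) (τ : G.cliqueFinset (k + 1)) :
    boundary G k σ τ ^ 2 = if (σ : Finset V) ⊆ (τ : Finset V) then 1 else 0 := by
  split_ifs with h
  · obtain ⟨v, hv, -, hστ⟩ := exists_eq_erase_of_subset (SimpleGraph.mem_cliqueFinset_iff.1 σ.2)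
      (SimpleGraph.mem_cliqueFinset_iff.1 τ.2) h
    rw [boundary_apply_erase σ τ hv hστ, faceSign_sq]
  · rw [boundary_apply_of_not_subset σ τ h]; ring

/-- The `k`-vertex cliques contained in a `(k+1)`-vertex clique are exactly its `k`-subsets, so
there are `k+1` of them. [folklore] -/
lemma card_cliqueFinset_filter_subset (k : ℕ) {τ : Finset V} (hτ : G.IsNClique (k + 1) τ) :
    #((G.cliqueFinset k).filter (fun ρ => ρ ⊆ τ)) = k + 1 := by
  have hset : (G.cliqueFinset k).filter (fun ρ => ρ ⊆ τ) = τ.powersetCard k := by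
    ext ρ
    simp only [mem_filter, SimpleGraph.mem_cliqueFinset_iff, mem_powersetCard,
      SimpleGraph.isNClique_iff]
    constructor
    · rintro ⟨⟨-, hc⟩, hs⟩
      exact ⟨hs, hc⟩
    · rintro ⟨hs, hc⟩
      exact ⟨⟨hτ.isClique.subset (Finset.coe_subset.2 hs), hc⟩, hs⟩
  rw [hset, card_powersetCard, hτ.card_eq, Nat.choose_succ_self_right]

/-- Diagonal of the up Laplacian: `(∂_{k+1} ∂_{k+1}ᵀ)_{σσ} = deg σ`.
[cite: HorakJost2013, §2 (explicit expression for `(L^{up}_i)_{(e_[F], e_[F])}` with `w ≡ 1`)] -/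
theorem upLaplacian_apply_self (k : ℕ) (σ : G.cliqueFinset (k + 1)) :
    upLaplacian G k σ σ = (upDegree G k σ : ℤ) := by
  simp only [upLaplacian, Matrix.mul_apply, Matrix.transpose_apply, ← pow_two, boundary_sq]
  rw [upDegree_def, card_filter, Nat.cast_sum]
  rw [← sum_coe_sort (G.cliqueFinset (k + 2))]
  refine sum_congr rfl fun τ _ => ?_
  split_ifs <;> simp

/-- Diagonal of the down Laplacian: `(∂_kᵀ ∂_k)_{ττ} = k+1`, the number of facets of a `k`-simplex.
[cite: HorakJost2013, §2 (explicit expression for `(L^{down}_i)_{(e_[F], e_[F])}` with `w ≡ 1`)] -/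
theorem downLaplacian_apply_self (k : ℕ) (τ : G.cliqueFinset (k + 1)) :
    downLaplacian G k τ τ = (k : ℤ) + 1 := by
  simp only [downLaplacian, Matrix.mul_apply, Matrix.transpose_apply, ← pow_two, boundary_sq]
  have h := card_cliqueFinset_filter_subset k (SimpleGraph.mem_cliqueFinset_iff.1 τ.2)
  rw [card_filter, ← sum_coe_sort (G.cliqueFinset k)] at h
  have h' := congrArg (fun n : ℕ => (n : ℤ)) h
  simp only [Nat.cast_sum, Nat.cast_ite, Nat.cast_one, Nat.cast_zero, Nat.cast_add] at h'
  rw [← h']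

/-- Diagonal of the combinatorial Laplacian: `(L_k)_{σσ} = deg σ + (k+1)`. [folklore] -/
theorem laplacian_apply_self (k : ℕ) (σ : G.cliqueFinset (k + 1)) :
    laplacian G k σ σ = (upDegree G k σ : ℤ) + ((k : ℤ) + 1) := by
  rw [laplacian, Matrix.add_apply, upLaplacian_apply_self, downLaplacian_apply_self]

/-- Double counting of the face relation between `k`- and `(k+1)`-simplices:
`Σ_σ deg σ = (k+2) · N_{k+2}`. [folklore] -/
theorem sum_upDegree (k : ℕ) :
    ∑ σ ∈ G.cliqueFinset (k + 1), (upDegree G k σ : ℤ) = ((k : ℤ) + 2) * #(G.cliqueFinset (k + 2)) := by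
  simp only [upDegree_def, card_filter, Nat.cast_sum, Nat.cast_ite, Nat.cast_one, Nat.cast_zero]
  rw [sum_comm]
  have hin : ∀ τ ∈ G.cliqueFinset (k + 2),
      (∑ σ ∈ G.cliqueFinset (k + 1), if σ ⊆ τ then (1 : ℤ) else 0) = (k : ℤ) + 2 := by
    intro τ hτ
    rw [sum_boole, card_cliqueFinset_filter_subset (k + 1) (SimpleGraph.mem_cliqueFinset_iff.1 hτ)]
    push_cast; ring
  rw [sum_congr rfl hin, sum_const, nsmul_eq_mul]
  ring

variable (G)

/-- **Trace of the combinatorial Laplacian of a clique complex.**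
`Tr L_k = (k+1) · N_{k+1} + (k+2) · N_{k+2}`, where `N_j` is the number of `j`-vertex cliques of `G`.
[folklore] -/
theorem trace_laplacian (k : ℕ) :
    (laplacian G k).trace = ((k : ℤ) + 1) * #(G.cliqueFinset (k + 1)) +
      ((k : ℤ) + 2) * #(G.cliqueFinset (k + 2)) := by
  simp only [Matrix.trace, Matrix.diag_apply, laplacian_apply_self, sum_add_distrib, sum_const,
    card_univ, Fintype.card_coe, nsmul_eq_mul]
  rw [sum_coe_sort (G.cliqueFinset (k + 1)) (fun σ => (upDegree G k σ : ℤ)), sum_upDegree]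
  ring

/-- The normalised ("relative") trace of `L_k`: `Tr L_k / N_{k+1}`, as a rational number
(`0` when there is no `k`-simplex, by `x / 0 = 0`). [cite: IaconisEtAl2026, §4.1, eq. (18)] -/
noncomputable def relTrace (k : ℕ) : ℚ := ((laplacian G k).trace : ℚ) / #(G.cliqueFinset (k + 1))

/-- **The first Laplacian moment is a clique-count ratio.**  Whenever `G` has a `(k+1)`-vertex clique,
`Tr L_k / N_{k+1} = (k+1) + (k+2) · N_{k+2} / N_{k+1}`.  In the convention of
[IaconisEtAl2026] (`Δ^Γ_k` acts on `k`-vertex cliques, so `tr[Δ^Γ_k] = relTrace G (k-1)`) this reads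
`tr[Δ^Γ_k] = k + (k+1) · N_{k+1}/N_k`. [folklore] -/
theorem relTrace_eq (k : ℕ) (h : (G.cliqueFinset (k + 1)).Nonempty) :
    relTrace G k = ((k : ℚ) + 1) + ((k : ℚ) + 2) * #(G.cliqueFinset (k + 2)) / #(G.cliqueFinset (k + 1)) := by
  have hN : (#(G.cliqueFinset (k + 1)) : ℚ) ≠ 0 := by
    exact_mod_cast (card_pos.2 h).ne'
  rw [relTrace, trace_laplacian]
  push_cast
  field_simp

/-- `L_k` is a symmetric matrix. [folklore] -/
theorem laplacian_transpose (k : ℕ) : (laplacian G k)ᵀ = laplacian G k := by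
  simp [laplacian, upLaplacian, downLaplacian, Matrix.transpose_add, Matrix.transpose_mul]

/-! ## The chain-complex identity `∂_k ∂_{k+1} = 0`

This checks that the signs in `boundary` are the simplicial ones: for a `k`-vertex clique `ρ`
inside a `(k+2)`-vertex clique `τ` with `τ ∖ ρ = {a < b}`, the two intermediate simplices
`τ.erase a`, `τ.erase b` contribute opposite signs. -/

variable {G}

/-- The `(ρ, τ)` entry of `∂_k ∂_{k+1}` vanishes when `ρ ⊆ τ` and `τ ∖ ρ = {a < b}`: the two
intermediate simplices `τ.erase a`, `τ.erase b` carry opposite signs. [folklore] -/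
private lemma sum_boundary_mul_boundary_eq_zero {k : ℕ} (ρ : G.cliqueFinset k)
    (τ : G.cliqueFinset (k + 2)) (hρτ : (ρ : Finset V) ⊆ (τ : Finset V)) {a b : V} (hab : a < b)
    (hdiff : (τ : Finset V) \ (ρ : Finset V) = {a, b}) :
    ∑ σ : G.cliqueFinset (k + 1), boundary G k ρ σ * boundary G (k + 1) σ τ = 0 := by
  have hτ := SimpleGraph.mem_cliqueFinset_iff.1 τ.2
  have ha : a ∈ (τ : Finset V) \ (ρ : Finset V) := by rw [hdiff]; simp
  have hb : b ∈ (τ : Finset V) \ (ρ : Finset V) := by rw [hdiff]; simp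
  rw [mem_sdiff] at ha hb
  have hσa : G.IsNClique (k + 1) ((τ : Finset V).erase a) := by
    simpa using hτ.erase_of_mem ha.1
  have hσb : G.IsNClique (k + 1) ((τ : Finset V).erase b) := by
    simpa using hτ.erase_of_mem hb.1
  have hρa : (ρ : Finset V) = ((τ : Finset V).erase b).erase a := by
    ext x
    simp only [mem_erase]
    constructor
    · intro hx
      exact ⟨fun h => ha.2 (h ▸ hx), fun h => hb.2 (h ▸ hx), hρτ hx⟩
    · rintro ⟨hxa, hxb, hxτ⟩
      by_contra hxρ
      have hx : x ∈ (τ : Finset V) \ (ρ : Finset V) := mem_sdiff.2 ⟨hxτ, hxρ⟩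
      rw [hdiff, mem_insert, mem_singleton] at hx
      rcases hx with h | h
      · exact hxa h
      · exact hxb h
  have hρb : (ρ : Finset V) = ((τ : Finset V).erase a).erase b := by
    rw [hρa, erase_right_comm]
  have hne : (⟨(τ : Finset V).erase a, SimpleGraph.mem_cliqueFinset_iff.2 hσa⟩ : G.cliqueFinset (k + 1)) ≠
      ⟨(τ : Finset V).erase b, SimpleGraph.mem_cliqueFinset_iff.2 hσb⟩ := by
    intro h
    exact hab.ne ((erase_inj _ ha.1).1 (congrArg Subtype.val h))
  rw [Fintype.sum_eq_add _ _ hne]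
  · have e1 : boundary G k ρ ⟨(τ : Finset V).erase a, SimpleGraph.mem_cliqueFinset_iff.2 hσa⟩ =
        faceSign ((τ : Finset V).erase a) b :=
      boundary_apply_erase _ _ (by rw [mem_erase]; exact ⟨hab.ne', hb.1⟩) hρb
    have e2 : boundary G (k + 1) ⟨(τ : Finset V).erase a, SimpleGraph.mem_cliqueFinset_iff.2 hσa⟩ τ =
        faceSign (τ : Finset V) a :=
      boundary_apply_erase _ _ ha.1 rfl
    have e3 : boundary G k ρ ⟨(τ : Finset V).erase b, SimpleGraph.mem_cliqueFinset_iff.2 hσb⟩ =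
        faceSign ((τ : Finset V).erase b) a :=
      boundary_apply_erase _ _ (by rw [mem_erase]; exact ⟨hab.ne, ha.1⟩) hρa
    have e4 : boundary G (k + 1) ⟨(τ : Finset V).erase b, SimpleGraph.mem_cliqueFinset_iff.2 hσb⟩ τ =
        faceSign (τ : Finset V) b :=
      boundary_apply_erase _ _ hb.1 rfl
    rw [e1, e2, e3, e4, faceSign_erase_of_gt hab ha.1, faceSign_erase_of_lt hab]
    ring
  · rintro σ ⟨hσa', hσb'⟩
    by_cases h1 : (ρ : Finset V) ⊆ (σ : Finset V)
    · by_cases h2 : (σ : Finset V) ⊆ (τ : Finset V)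
      · exfalso
        obtain ⟨v, hv, hvσ, hσv⟩ :=
          exists_eq_erase_of_subset (SimpleGraph.mem_cliqueFinset_iff.1 σ.2) hτ h2
        have hvρ : v ∉ (ρ : Finset V) := fun h => hvσ (h1 h)
        have hv' : v ∈ (τ : Finset V) \ (ρ : Finset V) := mem_sdiff.2 ⟨hv, hvρ⟩
        rw [hdiff, mem_insert, mem_singleton] at hv'
        rcases hv' with h | h
        · rw [h] at hσv
          exact hσa' (Subtype.ext hσv)
        · rw [h] at hσv
          exact hσb' (Subtype.ext hσv)
      · rw [boundary_apply_of_not_subset σ τ h2, mul_zero]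
    · rw [boundary_apply_of_not_subset ρ σ h1, zero_mul]

variable (G)

/-- **The boundary of a boundary is zero**: `∂_k ∂_{k+1} = 0` for the clique complex, i.e. the
matrices `boundary G k` form a chain complex (so the signs used are the simplicial ones).
[cite: HorakJost2013, §2 ("It is straightforward to check that `δ_i δ_{i-1} = 0`")] -/
theorem boundary_mul_boundary (k : ℕ) : boundary G k * boundary G (k + 1) = 0 := by
  ext ρ τ
  rw [Matrix.mul_apply, Matrix.zero_apply]
  by_cases hρτ : (ρ : Finset V) ⊆ (τ : Finset V)
  · have hρ := SimpleGraph.mem_cliqueFinset_iff.1 ρ.2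
    have hτ := SimpleGraph.mem_cliqueFinset_iff.1 τ.2
    have hcard : #((τ : Finset V) \ (ρ : Finset V)) = 2 := by
      rw [card_sdiff_of_subset hρτ, hτ.card_eq, hρ.card_eq]; omega
    obtain ⟨a, b, hab, hdiff⟩ := card_eq_two.1 hcard
    rcases lt_or_gt_of_ne hab with hlt | hlt
    · exact sum_boundary_mul_boundary_eq_zero ρ τ hρτ hlt hdiff
    · rw [pair_comm] at hdiff
      exact sum_boundary_mul_boundary_eq_zero ρ τ hρτ hlt hdiff
  · refine sum_eq_zero fun σ _ => ?_
    by_cases h1 : (ρ : Finset V) ⊆ (σ : Finset V)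
    · have h2 : ¬ (σ : Finset V) ⊆ (τ : Finset V) := fun h => hρτ (h1.trans h)
      rw [boundary_apply_of_not_subset σ τ h2, mul_zero]
    · rw [boundary_apply_of_not_subset ρ σ h1, zero_mul]

/-- Hence the up and down Laplacians compose to zero: `(∂_kᵀ ∂_k)(∂_{k+1} ∂_{k+1}ᵀ) = 0` on
`k`-simplices. [folklore] -/
theorem downLaplacian_mul_upLaplacian (k : ℕ) : downLaplacian G k * upLaplacian G k = 0 := by
  rw [downLaplacian, upLaplacian, Matrix.mul_assoc, ← Matrix.mul_assoc (boundary G k),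
    boundary_mul_boundary, Matrix.zero_mul, Matrix.mul_zero]

/-! ## Non-negativity

Horak–Jost note that the three operators are "self-adjoint, non-negative" [cite: HorakJost2013, §2 (after Definition
2.1)]; for the integer matrices here this is positive semidefiniteness of `∂∂ᵀ`, `∂ᵀ∂` and their sum. -/

/-- The up Laplacian `∂_{k+1} ∂_{k+1}ᵀ` is positive semidefinite. [cite: HorakJost2013, §2] -/
theorem upLaplacian_posSemidef (k : ℕ) : (upLaplacian G k).PosSemidef := by
  have h := Matrix.posSemidef_self_mul_conjTranspose (boundary G (k + 1))
  rwa [Matrix.conjTranspose_eq_transpose_of_trivial] at h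

/-- The down Laplacian `∂_kᵀ ∂_k` is positive semidefinite. [cite: HorakJost2013, §2] -/
theorem downLaplacian_posSemidef (k : ℕ) : (downLaplacian G k).PosSemidef := by
  have h := Matrix.posSemidef_conjTranspose_mul_self (boundary G k)
  rwa [Matrix.conjTranspose_eq_transpose_of_trivial] at h

/-- The combinatorial Laplacian `L_k` is positive semidefinite (so its spectrum is non-negative and the multiplicity
of the eigenvalue `0` is what Betti-number estimators count). [cite: HorakJost2013, §2] -/
theorem laplacian_posSemidef (k : ℕ) : (laplacian G k).PosSemidef :=
  (upLaplacian_posSemidef G k).add (downLaplacian_posSemidef G k)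

end CliqueComplex

end Literature.Combinatorics.SimpleGraph
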